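import Mathlib
import Literature.MathematicalPhysics.QuantumFieldTheory.Balaban1983to89.B8Ineq130
import Literature.MathematicalPhysics.QuantumFieldTheory.Balaban1983to89.B10Eq26SiteGauge

/-
Copyright: publication-cell `pub-balaban` (b2b), seat b2b-balaban-b10 gen 26 (v1).  Literature leaf — lattice words
on `ℤ^d`, the principal-branch logarithm of a Banach algebra, unitaries of a C⋆-algebra, and one-line applications of
the cell's landed theorems only (`…B7Prop1Explicit`, `…B7Prop2Explicit`, `…B7Prop1Local`, `…B8Ineq130`,
`…MatrixLog`, `…B7BlockAvgLog`, `…B13Inv214Orbit`, `…B10Eq26SiteGauge`, imported BY NAME, nothing edited); every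
theorem is kernel-proved and tagged [folklore] or [cite: …] (a LOCATED printed shape); the objects are MODEL OBJECTS on `ℤ^d` with values in a unital
C⋆-algebra, never asserted to be Bałaban's; NO new cited facts, NO summit vocabulary.
-/

/-!
# `Balaban1983to89.B10Eq27AxialLog` — [Balaban1985UV3] (27)–(28) p. 263 TYPED: the configuration
# `B(c) = (1/i) log V(Γ_{y,c₋} ∪ c ∪ Γ_{c₊,y})` IS `(1/i) log` of the bond variable of `V` in the complete axial gauge
# based at `y` (paper B7 pp. 24–25, the cell's `B7Prop1Explicit.axialFn`), so the restrictions (13)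
# `|V(∂p′) − 1| < 2L²g₀p(g₀)` give (28) `|B(c)| ≤ 4L²|c₋ − y|g₀p(g₀) ≤ 8L²·3RM₁·g₀p(g₀)` through the cell's landed
# non-abelian Stokes ladder (`axial_bond_bound`) and logarithm (`MatrixLog.norm_mlog_le_two_mul`); `B(c)` is
# self-adjoint, the gauge-transformed bond variable is `exp iB(c)`, and the GAUGE-FIXING DATUM `hfix` of the lineage's
# typed (29) (`B10Eq26SiteGauge.eq29_of_unitaryGaugeFix`, b10 gen 25, HONEST SCOPE (v): «located and never
# constructed») is DISCHARGED by the axial gauge on the `ℤ^d` bond carrier: (26) + localization ⇒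
# `𝒫′₁(g₀, X, U₁) = 𝒫′₁(g₀, X, exp iB)` with `B` the configuration (27) of `U₁` itself

T. Bałaban, *Ultraviolet stability of three-dimensional lattice pure gauge field theories*, Commun. Math. Phys.
**102**, 255–275 (1985) [Balaban1985UV3] (cell paper B10; PDF `paper:balaban1985-cmp102-uv-stability-3d`, journal page
= PDF page + 254); T. Bałaban, *Averaging operations for lattice gauge theories*, Commun. Math. Phys. **98**, 17–51
(1985) [Balaban1985Averaging] (cell paper B7 = B10's reference [4]); B10's reference [7] = T. Bałaban, *The variational
problem and background fields in renormalization group method for lattice gauge theories*, Commun. Math. Phys. **102**,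
277–309 (1985) [Balaban1985Variational] (cell paper B11; identified from the reference list, journal p. 274, by
`…B10Eq26SiteGauge`).

CITATION HEADER (lean-in-tree rule).  The passages of B10 marked «p009» below were READ AS IMAGE for this module from
the render `b2b-balaban-ref1/pages/1985-cmp102-uv-stability-3d/1985-cmp102-uv-stability-3d-p009-x2.png` (journal
p. 263: the paragraph from *"Now we are ready"* through the displays (27), (28), (29)); the passages marked «p003»,
«p004», «p005» were READ AS IMAGE from the renders `…-p003-x2.png` (journal p. 257), `…-p004-x2.png` (p. 258),
`…-p005-x2.png` (p. 259, display (13)); the passage of p. 264 marked «re-keyed» is copied byte-for-byte from the header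
of `…B10Eq26SiteGauge` (which read it as image), and the B7 passages (pp. 24–25) marked «re-keyed B7» are copied
byte-for-byte from the header of `…B7Prop1Explicit` (b07, which read them as image from the B7 renders).  This module
adds NO cited fact; the manuscripts under audit are quoted for the SHAPES of definitions and hypotheses, never cited
for a disputed step.  Siblings imported BY NAME (byte-identical, nothing edited): `…B7Prop1Explicit` (b07: `Site`,
`Letter`, `hol`, `treeWord`, `revWord`, `disp`, `plaqWord`, `l1`, `gaugeAct`, `axialFn`, `U1`, `hol_append`,
`hol_revWord'`, `hol_gaugeAct_closed`, `disp_treeWord`, `axial_bond_bound`, `gaugeAct_mem`, `mlog_units_conj`),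
`…B7Prop2Explicit` (b07: `unitaryUnits`, `unitaryUnits_le_U1`, `star_mlog_eq_neg`, `hol_mem_of`), `…B7Prop1Local`
(b07: `InBox`, `AgreeOn`, `PlaqIn`, `clampCfg`, `clampCfg_agree`, `clampCfg_mem`, `norm_hol_plaqWord_clampCfg_le`),
`…B8Ineq130` (b08: `hol_one`, `axialFn_congr`; imported for these two [folklore] lemmas, nothing of paper B8 is
used), `…MatrixLog` (`mlog`, `exp_mlog`, `mlog_one`, `norm_mlog_le_two_mul`), `…B7BlockAvgLog` (`mlog_exp`),
`…B13Inv214Orbit` (b13: `Ends`, `gaugeAct`, `isUnit_of_mem_unitary`), `…B10Eq29TubeLine` (b10: `expLine`),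
`…B10Eq26SiteGauge` (b10 gen 25: `SiteGaugeInv`, `eq29_of_unitaryGaugeFix`, `expLine_one_one`).

WHY THIS MODULE (the open edge it closes, by name).  `…B10Eq26SiteGauge` (gen 25) typed (29) p. 263 as THREE
HYPOTHESES AND ONE LINE: (26) for site-dependent unitary-valued transformations (`SiteGaugeInv`), the localization
property (`hloc`), and the GAUGE-FIXING DATUM `hfix : ∀ X φ, φ ∈ sp' X → ∃ u, (∀ x, u x ∈ unitary 𝔸) ∧ ∀ b ∈ dep X,
(φᵘ) b = exp (gen X φ b)` — its HONEST SCOPE (v): «(29) IS CONDITIONAL ON A DATUM: the gauge fixing `hfix` is located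
(p. 263, Sect. F of [7]) and never constructed; (27) (the definition of `B`) and (28) (its bound) … are not typed —
`gen X φ` ("i𝓗(B)") and `dep X` ("X̃⁵") are abstract».  This module TYPES (27) and (28) on the `ℤ^d` bond carrier
(§2, §3) and DISCHARGES the datum there (§5): the axial gauge transformation `v₀(x) = V(Γ_{y,x})` of B7 p. 24 (b07's
`axialFn`) is unitary-valued for unitary-valued `V`, and the transformed bond variable is EXACTLY the loop holonomy
`V(Γ_{y,c₋} ∪ c ∪ Γ_{c₊,y})` of (27) (§1, `hol_contour27`), which equals `exp iB(c)` wherever `|V(…) − 1| < 1` (§2) —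
in particular on every bond `c` with `|c₋ − y|₁·2L²g₀p(g₀) < 1` under (13) (§3).  So on the real (unitary-valued)
configurations (29) holds with `gen X φ = iB_φ`, the configuration (27) OF `φ` ITSELF, from (26) + localization +
(13)-type plaquette bounds on the configurations of the space + «`X̃⁵ ⊂ □`» alone (`eq29_axial`, and
`eq29_axial_local` with the plaquette bounds only near `□₁`).  What is NOT obtained is print's representative: print
applies Sect. F of [7] and represents the gauge-transformed `U₁` as `exp i𝓗(B)` with `𝓗(B) = HB + A₁(B)` (Eq. (158)
of [7]) — a DIFFERENT gauge, in which `𝓗` is a function of the coarse data `B`; see HONEST SCOPE (i).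

WHAT IS PRINTED (verbatim).
* B10 p. 257 («p003»): *"we take ε₁ = g₀p(g₀), where p(g) = b₀(1 + log g⁻¹)^{p₀}, p₀ > 2 and b₀ is a sufficiently
  large absolute constant"*; *"Ω₁ ⊂ T₁ defined as a union of big blocks, i.e. blocks of the size M₁, of the unit
  lattice T₁, such that their distances to P are > RM₁. We take R = R₁(1 + log g₀⁻¹)^{r₀} = R₁r(g₀)"*.
* B10 p. 258 («p004»): *"The underintegral expression in Tρ₀ is invariant with respect to gauge transformations u
  fixed to 1 at points of the new lattice T^{(1)}, i.e. u(y) = 1 for y ∈ T^{(1)}. We remove this freedom in the domain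
  Ω₁ by a simple Faddeev–Popov procedure, using the identity"* (9) *"δ_{Ax(y)}(U) = ∏_{x∈B(y),x≠y} δ(U(Γ_{y,x}))"*;
  *"If a configuration U belongs to this region, then it satisfies the regularity conditions |U(∂p) − 1| < g₀p(g₀)
  on the domain Ω₀, and by Proposition 1 from [4] the configuration V = Ū satisfies the conditions |V(∂p′) − 1| <
  2L²g₀p(g₀) on Ω₀^{(1)}"*; (12): *"U satisfies axial gauge conditions on Ω₁"*.
* B10 p. 259 («p005»), display (13): *"χ₁ = ∏_{p′∈Ω₁^{(1)}} χ({|V(∂p′) − 1| < 2L²g₀p(g₀)}), χ′ = ∏_{b∈Ω₁} χ({|A′(b)| <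
  16·3²L²B₃g₀p(g₀)})"*.
* B10 p. 263 («p009»): *"Now we are ready to perform the most important operation, a renormalization of the
  interaction terms 𝒫′₁. Let us consider a term 𝒫′₁(g₀, X, U₁). The localization domain X is contained in a cube □
  of the size RM₁. We may assume that X̃⁵ ⊂ □ also, and a center of □ belongs to X. We apply the constructions and
  results of Sect. F [7]. According to these there exists a gauge transformation in a neighbourhood of □₁, where □₁
  is a cube of the size 3RM₁ and with the same center as □, such that the gauge transformed U₁ is represented as
  exp i𝓗(B) in the neighbourhood of □₁. The function 𝓗(B) is represented as 𝓗(B) = HB + A₁, where HB corresponds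
  to a linearized theory, and A₁ is a non-linear perturbation determined by Eq. (158) [7]. Let us explain now the
  configuration B, which plays an important role in our considerations. Let y denote the center of □. The
  configuration B restricted to □₁ is defined on □₁^{(1)} = □₁ ∩ T^{(1)} and for a bond c of this set is given by
  B(c) = (1/i) log V(Γ_{y,c₋} ∪ c ∪ Γ_{c₊,y}). (27) The characteristic functions χ₁ defined in (13) give the
  restrictions |V(∂p′) − 1| < 2L²g₀p(g₀), hence |B(c)| < 4L²|c₋ − y|g₀p(g₀) < 8L²3R₁M₁r(g₀)g₀p(g₀), (28) and for g₀
  sufficiently small the number on the right-hand side above is small. This bound, with a different absolute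
  constant, extends to the whole configuration B, and this assures that the theorems of [7] are applicable in the
  present situation. The bound (28) implies a similar bound for 𝓗(B), with the additional constant B₃ on the
  right-hand side. By the gauge invariance (26), we have 𝒫′₁(g₀, X, U₁) = 𝒫′₁(g₀, X, exp i𝓗(B)), (29)"*.
* B10 p. 264 («re-keyed»): *"The gauge invariance (26) implies the invariance with respect to the global
  transformations R(U), U ∈ G, hence the equality R(U)((δ/δ𝓗(b))𝒫′₁)(g₀, X, 1) = ((δ/δ𝓗(b))𝒫′₁)(g₀, X, 1). (31)"*.
* B7 pp. 24–25 («re-keyed B7»): *"let us introduce locally the axial gauge with the initial point `y`. This means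
  that we take the contours `Γ_{y,x} = [y, (y₁, …, y_{d−1}, x_d)] ∪ … ∪ [(y₁, x₂, …, x_d), x]` … and we make a gauge
  transformation `v₀` such that the gauge transformed configuration `V₀ = V^{v₀}` satisfies the conditions
  `V₀(Γ_{y,x}) = 1`. … The conditions `V₀(Γ_{y,x}) = 1` imply `V₀(x, x + e₁) = 1`, `|V₀(x, x + e₂) − 1| <
  |x₁ − y₁|α₀`, …"*; *"for `b ⊂ Δ(p′)` we have `|V₀,b − 1| < |b₋ − y|α₀ ≤ dLα₀`, hence `V₀,b = e^{iA_b}` and `|A_b| <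
  2|b₋ − y|α₀ ≤ 2dLα₀`"*.

THE MATHEMATICS ([folklore]; three remarks).  (M1) (27) IS THE AXIAL GAUGE (B10's own gauge conditions (9), (12)
p. 258 use the same contours `Γ_{y,x}`).  With `v₀(x) := V(Γ_{y,x})` (so `v₀(y) = 1`), the transformed bond variable of `c = ⟨x, x + e_μ⟩` is `v₀(x) V(c) v₀(x + e_μ)⁻¹ = V(Γ_{y,x}) V(c)
V(Γ_{y,x+e_μ})⁻¹ = V(Γ_{y,c₋} ∪ c ∪ Γ_{c₊,y})` — the holonomy of the closed contour of (27) read from `y` (§1,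
`hol_contour27`, pure group theory: `hol_append` + `hol_revWord'`).  Hence `B(c) = (1/i) log V₀(c)` and, inside the
disc of the logarithm series, `V₀(c) = exp iB(c)`: the axial gauge REPRESENTS `V` as `exp iB` near `y`.  (M2) (28).
b07's `axial_bond_bound` (the non-abelian Stokes ladder of B7 pp. 24–25, with every `O(1)` computed) gives `|V₀(c) −
1| ≤ |c₋ − y|₁·α` from `|V(∂p) − 1| ≤ α` on the unit plaquettes, and `|log X| ≤ 2|X − 1|` for `|X − 1| ≤ ½`
(`MatrixLog.norm_mlog_le_two_mul`); with (13)'s `α = 2L²g₀p(g₀)` this is the first member of (28), `|B(c)| ≤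
4L²|c₋ − y|₁ g₀p(g₀)`, valid as long as `|c₋ − y|₁·2L²g₀p(g₀) ≤ ½`; for `c₋` in the cube `□₁` of side `3RM₁` centred
at `y` (each coordinate of `c₋ − y` at most `3RM₁/2` in absolute value) `|c₋ − y|₁ ≤ (3/2)·3RM₁` in `d = 3`, whence the
second member `≤ 6L²·3RM₁·g₀p(g₀) ≤ 8L²·3RM₁·g₀p(g₀)` (print's `8`, with `R = R₁r(g₀)`), and the smallness proviso is
implied by `8L²·3RM₁·g₀p(g₀) ≤ 1` (print: *"for g₀ sufficiently small the number on the right-hand side above is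
small"*).  (M3) THE DATUM.  For unitary-valued `V` the transformation `v₀` is unitary-valued (products of unitaries),
`V₀(c)` is unitary, `iB(c) = log V₀(c)` is skew-adjoint for `|V₀(c) − 1| ≤ ¼` (b07's `star_mlog_eq_neg`), i.e. `B(c)`
is SELF-ADJOINT (the `𝔤`-valuedness of print's `B` in the `U(𝔸)` model), and `V^{v₀} = exp iB` on every bond with
`|c₋ − y|₁·α < 1`: this is gen 25's `hfix` with `u := v₀`, `gen X φ := iB_φ` based at the centre `y = y(X)` of `□ ∋ X`,
on any bond set `dep X` ("X̃⁵ ⊂ □") inside that radius.  The residual freedom is the global conjugation at `y`: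
`(V^u)₀(c) = u(y) V₀(c) u(y)⁻¹` and `B_{V^u}(c) = u(y) B_V(c) u(y)⁻¹` (§1, §2) — the mechanism of p. 264's sentence
before (31).

WHAT IS KERNEL-CERTIFIED.
(§1) THE CONTOUR OF (27) [folklore, group-valued configurations on `ℤ^d`]: `contour27 y x μ` (the word of `Γ_{y,c₋} ∪ c
  ∪ Γ_{c₊,y}` read from `y`, `c = ⟨x, x + e_μ⟩`, `Γ` = b07's `treeWord`); `disp_contour27` (it is closed);
  `hol_contour27` (ITS HOLONOMY IS THE AXIAL-GAUGE BOND VARIABLE `(V^{v₀})(c)`, (M1)); `hol_contour27_gaugeAct`,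
  `axialBond_gaugeAct` (residual covariance: `V ↦ V^u` conjugates it by `u(y)`).  Geometry of `□₁`: `l1_le_mul_of_natAbs_le`, `two_mul_l1_le`, `two_mul_l1_le_real` (`ℓ¹` versus coordinate bounds).
(§2) (27) [cite shape]: `B27 V y x μ := (−i) • mlog (hol V y (contour27 y x μ))` in a Banach algebra over `ℂ`;
  `B27_eq_axial`; `I_smul_B27` (`i•B = log V₀(c)`); `norm_B27` (`‖B‖ = ‖log V₀(c)‖`); `exp_I_smul_B27` (`exp(iB(c)) =
  V₀(c)` for `‖V₀(c) − 1‖ < 1`); `I_smul_B27_eq_of_hol_eq_exp` (uniqueness of the small generator: `V₀(c) = exp C`,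
  `‖C‖ < log 2` ⇒ `iB(c) = C`); `B27_gaugeAct` (`B_{V^u}(c) = u(y) B_V(c) u(y)⁻¹` for `u(y)` of norm-one type).
(§3) (28) [cite shape] for norm-bounded unit configurations (`U1`: `‖V_b‖, ‖V_b⁻¹‖ ≤ 1`) under `|V(∂p) − 1| ≤ α` on
  the unit plaquettes of `ℤ^d`: `norm_hol_contour27_sub_one_le` (`‖V₀(c) − 1‖ ≤ |c₋ − y|₁ α`, = b07's
  `axial_bond_bound` moved along `hol_contour27`); `norm_B27_le` (`‖B(c)‖ ≤ 2|c₋ − y|₁α` if `|c₋ − y|₁α ≤ ½`);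
  `exp_I_smul_B27_of_plaq`, `axialBond_eq_exp` (`V₀(c) = exp iB(c)` if `|c₋ − y|₁α < 1`); `B27_eq_zero_of_flat`
  (flat `V` ⇒ `B ≡ 0`) and `B27_eq_zero_dim_one` (`d = 1`: no plaquettes, `B ≡ 0`); IN PRINT'S LETTERS `eq28_first`
  (`α = 2L²g`, `g = "g₀p(g₀)"`: `‖B(c)‖ ≤ 4L²|c₋ − y|₁g`), `eq28` (`d = 3`, `c₋` in a cube of side `S` centred at `y`,
  `8L²Sg ≤ 1`: both members, second `≤ 8L²Sg`), `eq28_print` (`S = 3RM₁`, `R = R₁r`: `≤ 8L²·3R₁M₁r·g₀p`).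
(§3′) THE SAME UNDER THE PRINTED LOCAL HYPOTHESIS — (13) only for the plaquettes of a box `[lo, hi]` containing `y`,
  `c₋`, `c₊` (b07's clamping device `B7Prop1Local.clampCfg` + locality of tree transport `B8Ineq130.axialFn_congr`):
  `hol_contour27_congr`, `B27_congr` (LOCALITY of (27): determined by the bonds of the box);
  `norm_hol_contour27_sub_one_le_local`, `norm_B27_le_local`, `exp_I_smul_B27_local`, `eq28_print_local`.
(§4) UNITARY-VALUED CONFIGURATIONS (C⋆-algebra) [folklore]: `val_inv_eq_star`; `hol_contour27_mem_unitary`;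
  `U1_of_unitaryUnits` (b07's `unitaryUnits_le_U1`, pointwise); `I_smul_B27_mem_skewAdjoint` and `B27_mem_selfAdjoint`
  (`|c₋ − y|₁α ≤ ¼` ⇒ `iB(c)` skew-adjoint, `B(c)` self-adjoint); `exp_I_smul_B27_mem_unitary`.
(§5) THE JOIN WITH GEN 25 — THE DATUM DISCHARGED ON `ℤ^d` [folklore]: `latEnds d` (the bond `⟨x, x + e_μ⟩` of `ℤ^d` as
  b13's `Ends`), `vals`, `gaugeAct_latEnds_vals` (b13's value-level action `u(x) V_b u(x′)⁻¹` of [13] (3.28) IS b07's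
  `gaugeAct` on units); `unitCfg`, `val_unitCfg`, `vals_unitCfg`, `unitCfg_mem_unitaryUnits` (unitary-valued value
  configurations are unit configurations); `plaq`, `val_hol_plaqWord` (the plaquette variable `V(∂p)` at value
  level); `axial_gaugeFix` (THE DATUM: `∃ u` unitary-valued with `(Vᵘ)(c) = exp(iB_V(c))` on every bond with `|c₋ −
  y|₁α < 1` — `u = v₀`); `axialGen y` (`gen X φ := iB_φ` based at `y X`) and `eq29_axial` ((29) ON `ℤ^d`: (26) as
  `SiteGaugeInv (latEnds d) (E X)` + localization to `dep X` + (13)-type plaquette bounds `≤ α` on `sp' X` + `dep X`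
  within `ℓ¹`-radius `< 1/α` of `y X` ⇒ `E X φ = E X (expLine (axialGen y) 1 X φ 1)` on `sp' X` — gen 25's
  `eq29_of_unitaryGaugeFix` with `hfix := axial_gaugeFix`); the LOCAL forms `h44_of_plaq_local`, `axial_gaugeFix_local`,
  `eq29_axial_local` (plaquette bounds only for the plaquettes of a box `[lo X, hi X]` containing `y X` and the bonds of
  `dep X` — "a neighbourhood of □₁"); the TRUNCATED generator `axialGenLoc y N` (`iB_φ(c)` for
  `|c₋ − y X|₁ ≤ N X`, else `0`) with `axialGenLoc_mem_skewAdjoint` (`N X·α ≤ ¼` ⇒ skew-adjoint at EVERY bond — the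
  shape of the lineage's binder `hgen`), `norm_axialGenLoc_le` (`N X·α ≤ ½` ⇒ `‖gen X φ b‖ ≤ 2N X·α` at every bond —
  the shape of the lineage's `hbound` with `q = 0`), `eq29_axialLoc` ((29) with the truncated generator when `dep X`
  lies in the `N X`-ball and `N X·α < 1`).
(§6) NON-VACUITY: `B27_eq_zero_of_pureGauge` (a pure gauge `V = 1ʷ` has `B ≡ 0`: the axial gauge undoes it);
  `eq29_dim_one` — on `ℤ¹` (no plaquettes, `α = 0`, `dep X` arbitrary) `eq29_axial` yields: a (26)-invariant localized
  family is CONSTANT on the unitary-valued configurations (`E X φ = E X 1`) — (29) with content and all its hypotheses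
  jointly satisfiable with `D`, `E`, `dep` free.

HYPOTHESIS SHAPES (located, never asserted; in print's words).  (h13)/(h44) `∀ x κ μ, κ ≠ μ → ‖V(∂p_{x;κ,μ}) − 1‖ ≤
α` (§3: all unit plaquettes; §3′: those of a box, `PlaqIn lo hi`) — for the configuration `V = Ū` of (27): (13) p. 259
*"|V(∂p′) − 1| < 2L²g₀p(g₀)"* on `Ω₁^{(1)}` (`α = 2L²g₀p(g₀)`; on `Ω₀^{(1)}` it is the conclusion of *"Proposition 1
from [4]"*, p. 258), B7 (44); for the configurations `φ ∈ sp' X` of §5 (print's `U₁`, the argument of `𝒫′₁`): a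
plaquette regularity `≤ α` of the minimal configurations — print's route to the smallness of `𝓗(B)` goes through (28)
and *"the theorems of [7]"* instead (HONEST SCOPE (i)); for the field `U` of p. 258 it would be *"|U(∂p) − 1| <
g₀p(g₀) on the domain Ω₀"*; (hcube) `2|(c₋ − y)_κ| ≤ S` — *"□₁ is a cube of the size 3RM₁ and with the same center
as □"*, *"Let y denote the center of □"* (p. 263), `S = 3RM₁`, `R = R₁r(g₀)` (p. 257); (hsmall) `8L²Sg ≤ 1` — *"for
g₀ sufficiently small the number on the right-hand side above is small"* (p. 263); (h26) `SiteGaugeInv (latEnds d) (E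
X)` and (hloc) — (26) and the localization property p. 263, exactly gen 25's binders; (hdep) `dep X` within
`ℓ¹`-radius `< 1/α` (resp. `≤ N X`) of `y X` — *"X̃⁵ ⊂ □"*, *"in the neighbourhood of □₁"* (p. 263).

HONEST SCOPE.  (i) NOT PRINT'S `𝓗(B)`.  Print's representative after the gauge fixing of Sect. F of [7] is `exp
i𝓗(B)`, `𝓗(B) = HB + A₁(B)` (`H` the linearized minimizer operator, `A₁` from Eq. (158) of [7]), a FUNCTION OF THE
COARSE CONFIGURATION `B`, (27) being taken of the coarse field `V = Ū` on `T^{(1)}` of which `U₁` is the minimal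
configuration; NONE of `H`, `A₁`, Eq. (158), Sect. F of [7] is typed here.  §2–§3′ type (27)–(28) for ANY configuration
with small plaquette variables (print's `V`: hypothesis (13)), and §5 applies them to the argument `φ` of `𝒫′₁` itself
(print's `U₁`): the axial representative `exp iB_φ` is NOT claimed to be print's `exp i𝓗(B)` — the two are different
gauge copies of the same orbit, and the smallness of `B_φ` rests on a plaquette hypothesis on `φ` (HYPOTHESIS SHAPES),
not on (13) for `V`.  What (29)–(30) USE of the representative is (a) gauge equivalence to `U₁` near `□₁ ⊇ X̃⁵` and (b) a small
norm ((28) «implies a similar bound for 𝓗(B)»); the axial representative has (a) (`axial_gaugeFix`) and (b) in the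
form (28) itself (`norm_B27_le`, growing linearly with `|c₋ − y|₁` — fine on `□₁`, useless globally, whence the
truncation `axialGenLoc`); print's DERIVATIVE information on `𝓗(B)` (smoothness in `B`, needed for the expansion (30)
in the coarse variable and for (31)–(40)) has no counterpart for `B_φ`.  (ii) `ℤ^d`, NOT THE TORUS: sites `Fin d → ℤ`
(b07's carrier) index the lattice carrying the configuration — `T^{(1)}` for print's `V` in (27)–(28), the unit
lattice `T₁` for `U₁` in (29); `|c₋ − y|₁` counts lattice steps of that lattice (for `T^{(1)}` at most the distance in
unit-lattice lengths, so (28) as typed implies (28) in either reading of `|c₋ − y|`); `□₁^{(1)} = □₁ ∩ T^{(1)}`, `Ω₁`,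
big blocks, the torus identifications are not modelled; `dep X`, `y X`, `N X`, `lo X`, `hi X` are abstract data over a
`LocDomainSys`.  (iii) LOCALITY: §3/§5 assume the plaquette bound on ALL unit plaquettes of `ℤ^d` (as b07's
`axial_bond_bound`, its DIVERGENCE (a)); §3′ and the `_local` forms of §5 assume it only for the plaquettes of a box
containing `y` and the bonds concerned — print's (13) on `Ω₁^{(1)} ⊇` a neighbourhood of `□₁`; print's further sentence
*"This bound, with a different absolute constant, extends to the whole configuration B"* (beyond `□₁`: large-field
regions, the role of `R`) is NOT typed.  (iv) `≤` for print's `<`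
throughout; `|c₋ − y|` read as the `ℓ¹` distance (b07's reading of B7 p. 25; print's second member of (28) bounds it by
twice the side of `□₁`, consistent with `ℓ¹ ≤ 3·ℓ^∞` in `d = 3`: our `6` against print's `8`).  (v) `U(𝔸)` SLICE: `B(c)`
lives in the bond algebra `𝔸` and is proved SELF-ADJOINT; for `𝔸 = M_N(ℂ)` and `G = SU(N)` print's `B` is moreover
traceless — not typed (as in `…B10Eq26SiteGauge` HONEST SCOPE (iii)).  (vi) The transformation `u = v₀` is GLOBAL on
`ℤ^d` (cf. adv2's INFO on gen 25: `hfix` quantifies a global `u`); print's is *"in a neighbourhood of □₁"* — a global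
`u` is a special case of what (26) allows, so nothing is lost for (29).  (vii) NO BOUND OF PRINT IS IMPROVED, no
constant changes; no (23)–(25), no (30)–(40), no Theorem 1 or 2, no convergence, no continuum statement; NOT summit
progress, not Clay progress.  Cell GAPS: gen 25's HONEST SCOPE (v) moves from «datum located, never constructed» to
«datum CONSTRUCTED on the `ℤ^d` model for the axial representative `exp iB_φ`, under a located plaquette hypothesis on
`φ` (global or on a box); print's Sect. F representative `exp i𝓗(B)` still untyped».

SIBLING PRIOR ART (disclosed by name).  b07's `B7Prop1Explicit.bond_log` (`‖V₀(b) − 1‖ ≤ a/2 ≤ ½` within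
`ℓ¹`-radius `R` ⇒ `V₀(b) = exp(mlog V₀(b))`, `‖mlog V₀(b)‖ ≤ a`) is the UNIFORM-in-a-ball form of the same two Mathlib-
level facts (`exp_mlog`, `norm_mlog_le_two_mul`) that §2–§3 apply POINTWISE in print's site-dependent form (28); it is
not restated (different hypothesis and conclusion shapes), and `axial_bond_bound`, `star_mlog_eq_neg`,
`mlog_units_conj`, `unitaryUnits_le_U1`, `hol_mem_of` are used by name.  `…B8Ineq130.hol_one` / `axialFn_congr` and `…B7Prop1Local`'s clamping device are used by name (§3′ is b07's
localisation method applied to (27)); `…BlockAveraging.loopWord` is a different object (block-averaging contours, other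
signature) — hence the name `contour27` here.  `…B10Eq26SiteGauge` §8 (T2) `toy_axial_gaugeFix` is the ONE-BOND instance
of §5's `axial_gaugeFix` (there `gen = 0`); `…B13Inv214PolarChain` /
`…B13Inv214Orbit` concern `Gᶜ`-valued transformations and tubes and are not touched.  `lean search --decl` (2026-08-19) for
`contour27`, `latEnds`, `axialGen`, `unitCfg`, `val_inv_eq_star`, `two_mul_l1_le`, `plaq`: no prior declaration (the
names `B27`, `liftU`, `loopWord`, `hol_one` occur elsewhere with other meanings — `B8Ineq130.hol_one` is the one used);
Mathlib has no lattice gauge theory.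

RECORDS: cell GAPS C-b10g26-1 (this module), C-b10g25-1 UPDATE (b10-g26) (`hfix` discharged on `ℤ^d` for the axial
representative); DIVERGENCE D-b10.31 (axial representative `exp iB_φ` versus print's `exp i𝓗(B)`; `ℤ^d`; plaquette
hypothesis on `φ`; `≤`/`ℓ¹`; constant `6 ≤ 8`); no new bib key (keys used: Balaban1985UV3, Balaban1985Averaging,
Balaban1985Variational — all in references.bib).
-/

open NormedSpace

namespace Literature.MathematicalPhysics.QuantumFieldTheory.Balaban1983to89.B10Eq27AxialLog

open B7Prop1Explicit renaming Site → LSite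
open B7Prop1Explicit (Letter e hol stepHol treeWord axialFn revWord disp plaqWord l1 U1
  hol_append hol_revWord' hol_gaugeAct_closed disp_treeWord disp_append disp_cons disp_nil disp_revWord
  disp_plaqWord axial_bond_bound gaugeAct_mem mlog_units_conj hol_cons hol_nil stepHol_true stepHol_false)
open B7Prop2Explicit (unitaryUnits mem_unitaryUnits unitaryUnits_le_U1 star_mlog_eq_neg hol_mem_of)
open B7Prop1Local (InBox AgreeOn PlaqIn clampCfg clampCfg_agree clampCfg_mem norm_hol_plaqWord_clampCfg_le)
open B8Ineq130 (hol_one axialFn_congr)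
open MatrixLog (mlog exp_mlog mlog_one norm_mlog_le_two_mul)
open B13Inv214Orbit (Ends isUnit_of_mem_unitary)
open B10Eq29TubeLine (expLine)
open B10Eq26SiteGauge (SiteGaugeInv eq29_of_unitaryGaugeFix expLine_one_one)

/-! ## §1 The contour `Γ_{y,c₋} ∪ c ∪ Γ_{c₊,y}` of (27) and its holonomy (group-valued configurations on `ℤ^d`) -/

section Loop

variable {d : ℕ} {G : Type*} [Group G]

/-- The closed contour of (27) read from `y`: `Γ_{y,c₋} ∪ c ∪ Γ_{c₊,y}` for the bond `c = ⟨x, x + e_μ⟩`, with `Γ_{y,·}`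
b07's tree contour `treeWord` (B7 p. 24) and the return path the reversed tree contour to `c₊ = x + e_μ`.
[cite: Balaban1985UV3, (27) p.263] -/
def contour27 (y x : LSite d) (μ : Fin d) : List (Letter d) :=
  treeWord (x - y) ++ [(μ, true)] ++ revWord (treeWord (x + e μ - y))

/-- The contour of (27) is closed. [folklore] -/
theorem disp_contour27 (y x : LSite d) (μ : Fin d) : disp (contour27 y x μ) = 0 := by
  simp only [contour27, disp_append, disp_treeWord, disp_cons, disp_nil, add_zero, B7Prop1Explicit.Letter.vec_true,
    disp_revWord]
  abel

/-- **(M1): (27) is the axial gauge.**  The holonomy of `Γ_{y,c₋} ∪ c ∪ Γ_{c₊,y}` from `y` is the bond variable of `c =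
⟨x, x + e_μ⟩` in the complete axial gauge based at `y`: `V(Γ_{y,x}) V(c) V(Γ_{y,x+e_μ})⁻¹ = (V^{v₀})(c)` with b07's
`v₀ = axialFn V y` (B7 p. 24 *"V₀ = V^{v₀} satisfies the conditions V₀(Γ_{y,x}) = 1"*). [folklore] -/
theorem hol_contour27 (V : LSite d → Fin d → G) (y x : LSite d) (μ : Fin d) :
    hol V y (contour27 y x μ) = B7Prop1Explicit.gaugeAct (axialFn V y) V x μ := by
  have h1 : y + disp (treeWord (x - y)) = x := by rw [disp_treeWord, add_sub_cancel]
  have h2 : y + disp (treeWord (x - y) ++ [((μ, true) : Letter d)]) = x + e μ := by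
    rw [disp_append, disp_treeWord, disp_cons, disp_nil, add_zero, B7Prop1Explicit.Letter.vec_true]; abel
  rw [contour27, hol_append, hol_append, h1, h2,
    hol_revWord' V (x + e μ) (treeWord (x + e μ - y)) (by rw [disp_treeWord, add_sub_cancel]),
    hol_cons, hol_nil, mul_one, stepHol_true]
  rfl

/-- Residual covariance of (27): under `V ↦ V^u` the holonomy of the closed contour from `y` is conjugated by `u(y)`
(b07's `hol_gaugeAct_closed`) — the mechanism of p. 264 *"(26) implies the invariance with respect to the global
transformations R(U)"*. [folklore] -/
theorem hol_contour27_gaugeAct (u : LSite d → G) (V : LSite d → Fin d → G) (y x : LSite d) (μ : Fin d) :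
    hol (B7Prop1Explicit.gaugeAct u V) y (contour27 y x μ) = u y * hol V y (contour27 y x μ) * (u y)⁻¹ :=
  hol_gaugeAct_closed u V y _ (disp_contour27 y x μ)

/-- The axial-gauge bond variable of `V^u` is that of `V` conjugated by `u(y)`. [folklore] -/
theorem axialBond_gaugeAct (u : LSite d → G) (V : LSite d → Fin d → G) (y x : LSite d) (μ : Fin d) :
    B7Prop1Explicit.gaugeAct (axialFn (B7Prop1Explicit.gaugeAct u V) y) (B7Prop1Explicit.gaugeAct u V) x μ =
      u y * B7Prop1Explicit.gaugeAct (axialFn V y) V x μ * (u y)⁻¹ := by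
  rw [← hol_contour27, ← hol_contour27, hol_contour27_gaugeAct]

/-! ### Geometry of `□₁`: the `ℓ¹` distance `|c₋ − y|₁ = l1 (x − y)` against coordinate bounds -/

/-- `|v|₁ ≤ d·h` if every coordinate is at most `h` in absolute value. [folklore] -/
theorem l1_le_mul_of_natAbs_le {v : LSite d} {h : ℕ} (hv : ∀ κ, (v κ).natAbs ≤ h) : l1 v ≤ d * h := by
  unfold B7Prop1Explicit.l1
  calc ∑ κ, (v κ).natAbs ≤ ∑ _κ : Fin d, h := Finset.sum_le_sum fun κ _ => hv κ
    _ = d * h := by simp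

/-- `2|v|₁ ≤ d·S` if every coordinate satisfies `2|v_κ| ≤ S` (`v` in the cube of side `S` centred at `0`). [folklore] -/
theorem two_mul_l1_le {v : LSite d} {S : ℕ} (hv : ∀ κ, 2 * (v κ).natAbs ≤ S) : 2 * l1 v ≤ d * S := by
  unfold B7Prop1Explicit.l1
  rw [Finset.mul_sum]
  calc ∑ κ, 2 * (v κ).natAbs ≤ ∑ _κ : Fin d, S := Finset.sum_le_sum fun κ _ => hv κ
    _ = d * S := by simp

/-- Real-valued form: `2|v|₁ ≤ d·T` if `2|v_κ| ≤ T` for every coordinate. [folklore] -/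
theorem two_mul_l1_le_real {v : LSite d} {T : ℝ} (hv : ∀ κ, 2 * ((v κ).natAbs : ℝ) ≤ T) :
    2 * (l1 v : ℝ) ≤ d * T := by
  unfold B7Prop1Explicit.l1
  push_cast
  rw [Finset.mul_sum]
  calc ∑ κ, 2 * ((v κ).natAbs : ℝ) ≤ ∑ _κ : Fin d, T := Finset.sum_le_sum fun κ _ => hv κ
    _ = d * T := by simp

end Loop

/-! ## §2 The configuration `B` of (27) in a Banach algebra over `ℂ` -/

section Def27

variable {d : ℕ} {𝔸 : Type*} [NormedRing 𝔸] [NormedAlgebra ℂ 𝔸]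

/-- **(27)**: `B(c) = (1/i) log V(Γ_{y,c₋} ∪ c ∪ Γ_{c₊,y})` for the bond `c = ⟨x, x + e_μ⟩`, `log` the principal-branch
series `MatrixLog.mlog` (B7 (21)/(26)), `1/i = −i`. [cite: Balaban1985UV3, (27) p.263] -/
noncomputable def B27 (V : LSite d → Fin d → 𝔸ˣ) (y x : LSite d) (μ : Fin d) : 𝔸 :=
  (-Complex.I) • mlog ((hol V y (contour27 y x μ) : 𝔸ˣ) : 𝔸)

/-- (27) = `(1/i) log` of the axial-gauge bond variable (M1). [cite: Balaban1985UV3, (27) p.263] -/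
theorem B27_eq_axial (V : LSite d → Fin d → 𝔸ˣ) (y x : LSite d) (μ : Fin d) :
    B27 V y x μ = (-Complex.I) • mlog ((B7Prop1Explicit.gaugeAct (axialFn V y) V x μ : 𝔸ˣ) : 𝔸) := by
  rw [B27, hol_contour27]

/-- `iB(c) = log V₀(c)`. [folklore] -/
theorem I_smul_B27 (V : LSite d → Fin d → 𝔸ˣ) (y x : LSite d) (μ : Fin d) :
    Complex.I • B27 V y x μ = mlog ((hol V y (contour27 y x μ) : 𝔸ˣ) : 𝔸) := by
  rw [B27, smul_smul, mul_neg, Complex.I_mul_I, neg_neg, one_smul]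

/-- `‖B(c)‖ = ‖log V₀(c)‖`. [folklore] -/
theorem norm_B27 (V : LSite d → Fin d → 𝔸ˣ) (y x : LSite d) (μ : Fin d) :
    ‖B27 V y x μ‖ = ‖mlog ((hol V y (contour27 y x μ) : 𝔸ˣ) : 𝔸)‖ := by
  rw [B27, norm_smul, norm_neg, Complex.norm_I, one_mul]

variable [CompleteSpace 𝔸]

/-- `exp(iB(c)) = V(Γ_{y,c₋} ∪ c ∪ Γ_{c₊,y}) = V₀(c)` inside the disc of the logarithm (`MatrixLog.exp_mlog`): the
axial gauge represents the configuration as `exp iB` (p. 263 *"represented as exp i𝓗(B)"*, here for the axial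
representative — HONEST SCOPE (i)). [folklore] -/
theorem exp_I_smul_B27 (V : LSite d → Fin d → 𝔸ˣ) (y x : LSite d) (μ : Fin d)
    (h : ‖((hol V y (contour27 y x μ) : 𝔸ˣ) : 𝔸) - 1‖ < 1) :
    exp (Complex.I • B27 V y x μ) = ((hol V y (contour27 y x μ) : 𝔸ˣ) : 𝔸) := by
  rw [I_smul_B27, exp_mlog h]

/-- Uniqueness of the small generator: if `V₀(c) = exp C` with `‖C‖ < log 2` then `iB(c) = C`
(`B7BlockAvgLog.mlog_exp`). [folklore] -/
theorem I_smul_B27_eq_of_hol_eq_exp (V : LSite d → Fin d → 𝔸ˣ) (y x : LSite d) (μ : Fin d) {C : 𝔸}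
    (hC : ‖C‖ < Real.log 2) (h : ((hol V y (contour27 y x μ) : 𝔸ˣ) : 𝔸) = exp C) :
    Complex.I • B27 V y x μ = C := by
  rw [I_smul_B27, h, B7BlockAvgLog.mlog_exp hC]

end Def27

section Covariance

variable {d : ℕ} {𝔸 : Type*} [NormedRing 𝔸] [NormOneClass 𝔸] [NormedAlgebra ℂ 𝔸] [CompleteSpace 𝔸]

/-- Residual covariance of (27): `B_{V^u}(c) = u(y) B_V(c) u(y)⁻¹` when `u(y)` and its inverse have norm `≤ 1` and
`V₀(c)` lies in the disc of the logarithm (b07's `mlog_units_conj`) — for constant `u ≡ W` this is `B ↦ W B W⁻¹`,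
p. 264 before (31). [folklore] -/
theorem B27_gaugeAct {u : LSite d → 𝔸ˣ} (V : LSite d → Fin d → 𝔸ˣ) (y x : LSite d) (μ : Fin d) (hu : u y ∈ U1 𝔸)
    (h : ‖((hol V y (contour27 y x μ) : 𝔸ˣ) : 𝔸) - 1‖ < 1) :
    B27 (B7Prop1Explicit.gaugeAct u V) y x μ = (u y : 𝔸) * B27 V y x μ * ((u y)⁻¹ : 𝔸ˣ) := by
  rw [B27, B27, hol_contour27_gaugeAct, Units.val_mul, Units.val_mul, mlog_units_conj hu h, mul_smul_comm,
    smul_mul_assoc]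

end Covariance

/-! ## §3 (28): the bound on `B` from the plaquette restrictions (13) -/

section Bound28

variable {d : ℕ} {𝔸 : Type*} [NormedRing 𝔸] [NormOneClass 𝔸]

/-- `‖V(Γ_{y,c₋} ∪ c ∪ Γ_{c₊,y}) − 1‖ ≤ |c₋ − y|₁·α` under `|V(∂p) − 1| ≤ α` on the unit plaquettes of `ℤ^d` — b07's
`axial_bond_bound` (B7 pp. 24–25 *"|V₀,b − 1| < |b₋ − y|α₀"*) moved along `hol_contour27`. [cite: Balaban1985Averaging, pp.24–25] -/
theorem norm_hol_contour27_sub_one_le (V : LSite d → Fin d → 𝔸ˣ) (hV : ∀ x κ, V x κ ∈ U1 𝔸) (y : LSite d) {α : ℝ}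
    (h44 : ∀ (x : LSite d) (κ μ : Fin d), κ ≠ μ → ‖((hol V x (plaqWord κ μ) : 𝔸ˣ) : 𝔸) - 1‖ ≤ α) (hα : 0 ≤ α)
    (x : LSite d) (μ : Fin d) : ‖((hol V y (contour27 y x μ) : 𝔸ˣ) : 𝔸) - 1‖ ≤ l1 (x - y) * α := by
  rw [hol_contour27]; exact axial_bond_bound V hV y h44 hα x μ

variable [NormedAlgebra ℂ 𝔸] [CompleteSpace 𝔸]

/-- **(28), generic form**: `‖B(c)‖ ≤ 2|c₋ − y|₁·α` as long as `|c₋ − y|₁·α ≤ ½` (`|log X| ≤ 2|X − 1|`,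
`MatrixLog.norm_mlog_le_two_mul`) — B7 p. 25 *"|A_b| < 2|b₋ − y|α₀"*. [cite: Balaban1985UV3, (28) p.263] -/
theorem norm_B27_le (V : LSite d → Fin d → 𝔸ˣ) (hV : ∀ x κ, V x κ ∈ U1 𝔸) (y : LSite d) {α : ℝ}
    (h44 : ∀ (x : LSite d) (κ μ : Fin d), κ ≠ μ → ‖((hol V x (plaqWord κ μ) : 𝔸ˣ) : 𝔸) - 1‖ ≤ α) (hα : 0 ≤ α)
    (x : LSite d) (μ : Fin d) (hsmall : (l1 (x - y) : ℝ) * α ≤ 1 / 2) :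
    ‖B27 V y x μ‖ ≤ 2 * (l1 (x - y) * α) := by
  rw [norm_B27]
  have h := norm_hol_contour27_sub_one_le V hV y h44 hα x μ
  exact (norm_mlog_le_two_mul (h.trans hsmall)).trans (by linarith)

/-- `exp(iB(c)) = V₀(c)` on every bond with `|c₋ − y|₁·α < 1`. [folklore] -/
theorem exp_I_smul_B27_of_plaq (V : LSite d → Fin d → 𝔸ˣ) (hV : ∀ x κ, V x κ ∈ U1 𝔸) (y : LSite d) {α : ℝ}
    (h44 : ∀ (x : LSite d) (κ μ : Fin d), κ ≠ μ → ‖((hol V x (plaqWord κ μ) : 𝔸ˣ) : 𝔸) - 1‖ ≤ α) (hα : 0 ≤ α)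
    (x : LSite d) (μ : Fin d) (hlt : (l1 (x - y) : ℝ) * α < 1) :
    exp (Complex.I • B27 V y x μ) = ((hol V y (contour27 y x μ) : 𝔸ˣ) : 𝔸) :=
  exp_I_smul_B27 V y x μ ((norm_hol_contour27_sub_one_le V hV y h44 hα x μ).trans_lt hlt)

/-- The gauge-transformed configuration is represented as `exp iB`: `(V^{v₀})(c) = exp(iB(c))` on every bond with
`|c₋ − y|₁·α < 1` (p. 263, for the axial representative — HONEST SCOPE (i)). [folklore] -/
theorem axialBond_eq_exp (V : LSite d → Fin d → 𝔸ˣ) (hV : ∀ x κ, V x κ ∈ U1 𝔸) (y : LSite d) {α : ℝ}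
    (h44 : ∀ (x : LSite d) (κ μ : Fin d), κ ≠ μ → ‖((hol V x (plaqWord κ μ) : 𝔸ˣ) : 𝔸) - 1‖ ≤ α) (hα : 0 ≤ α)
    (x : LSite d) (μ : Fin d) (hlt : (l1 (x - y) : ℝ) * α < 1) :
    ((B7Prop1Explicit.gaugeAct (axialFn V y) V x μ : 𝔸ˣ) : 𝔸) = exp (Complex.I • B27 V y x μ) := by
  rw [exp_I_smul_B27_of_plaq V hV y h44 hα x μ hlt, hol_contour27]

omit [CompleteSpace 𝔸] in
/-- A flat configuration (`V(∂p) = 1` on all unit plaquettes) has `B ≡ 0`: the axial gauge gauges it to `1`. [folklore] -/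
theorem B27_eq_zero_of_flat (V : LSite d → Fin d → 𝔸ˣ) (hV : ∀ x κ, V x κ ∈ U1 𝔸) (y : LSite d)
    (hflat : ∀ (x : LSite d) (κ μ : Fin d), κ ≠ μ → ((hol V x (plaqWord κ μ) : 𝔸ˣ) : 𝔸) = 1)
    (x : LSite d) (μ : Fin d) : B27 V y x μ = 0 := by
  have h := norm_hol_contour27_sub_one_le V hV y (α := 0)
    (fun x κ μ hne => by rw [hflat x κ μ hne, sub_self, norm_zero]) le_rfl x μ
  rw [mul_zero] at h
  have h1 : ((hol V y (contour27 y x μ) : 𝔸ˣ) : 𝔸) = 1 := by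
    rw [← sub_eq_zero]; exact norm_le_zero_iff.mp h
  rw [B27, h1, mlog_one, smul_zero]

omit [CompleteSpace 𝔸] in
/-- `d = 1`: there are no plaquettes, every configuration is flat, `B ≡ 0`. [folklore] -/
theorem B27_eq_zero_dim_one (V : LSite 1 → Fin 1 → 𝔸ˣ) (hV : ∀ x κ, V x κ ∈ U1 𝔸) (y x : LSite 1) (μ : Fin 1) :
    B27 V y x μ = 0 :=
  B27_eq_zero_of_flat V hV y (fun _ κ μ hne => absurd (Subsingleton.elim κ μ) hne) x μ

omit [CompleteSpace 𝔸] in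
/-- A pure gauge `V = 1ʷ` (`V(x, x + e_μ) = w(x) w(x + e_μ)⁻¹`) has `B ≡ 0`. [folklore] -/
theorem B27_eq_zero_of_pureGauge (w : LSite d → 𝔸ˣ) (hw : ∀ x, w x ∈ U1 𝔸) (y x : LSite d) (μ : Fin d) :
    B27 (B7Prop1Explicit.gaugeAct w 1) y x μ = 0 := by
  refine B27_eq_zero_of_flat (B7Prop1Explicit.gaugeAct w 1)
    (gaugeAct_mem (V := 1) (fun _ _ => (U1 𝔸).one_mem) hw) y (fun z κ ν _ => ?_) x μ
  rw [hol_gaugeAct_closed w 1 z _ (disp_plaqWord κ ν), hol_one, mul_one, mul_inv_cancel, Units.val_one]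

/-! ### (28) in print's letters -/

/-- **(28), first member**: under (13) `|V(∂p′) − 1| ≤ 2L²g` (`g = "g₀p(g₀)"`), `‖B(c)‖ ≤ 4L²|c₋ − y|₁g` on every bond
with `|c₋ − y|₁·2L²g ≤ ½`. [cite: Balaban1985UV3, (28) p.263] -/
theorem eq28_first (V : LSite d → Fin d → 𝔸ˣ) (hV : ∀ x κ, V x κ ∈ U1 𝔸) (y : LSite d) {L g : ℝ}
    (hLg : 0 ≤ L ^ 2 * g)
    (h13 : ∀ (x : LSite d) (κ μ : Fin d), κ ≠ μ → ‖((hol V x (plaqWord κ μ) : 𝔸ˣ) : 𝔸) - 1‖ ≤ 2 * L ^ 2 * g)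
    (x : LSite d) (μ : Fin d) (hsmall : (l1 (x - y) : ℝ) * (2 * L ^ 2 * g) ≤ 1 / 2) :
    ‖B27 V y x μ‖ ≤ 4 * L ^ 2 * l1 (x - y) * g := by
  have h := norm_B27_le V hV y h13 (by linarith) x μ hsmall
  linarith

/-- **(28), both members, `d = 3`**: `c₋ = x` in the cube of side `S` centred at `y` (`2|(x − y)_κ| ≤ S`) and the
smallness `8L²Sg ≤ 1` (*"for g₀ sufficiently small the number on the right-hand side above is small"*) give
`‖B(c)‖ ≤ 4L²|c₋ − y|₁g ≤ 8L²Sg` (in fact `≤ 6L²Sg`). [cite: Balaban1985UV3, (28) p.263] -/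
theorem eq28 (V : LSite 3 → Fin 3 → 𝔸ˣ) (hV : ∀ x κ, V x κ ∈ U1 𝔸) (y : LSite 3) {L g : ℝ} (hg : 0 ≤ g)
    (h13 : ∀ (x : LSite 3) (κ μ : Fin 3), κ ≠ μ → ‖((hol V x (plaqWord κ μ) : 𝔸ˣ) : 𝔸) - 1‖ ≤ 2 * L ^ 2 * g)
    {S : ℕ} {x : LSite 3} (hx : ∀ κ, 2 * ((x - y) κ).natAbs ≤ S) (hsmall : 8 * L ^ 2 * S * g ≤ 1) (μ : Fin 3) :
    ‖B27 V y x μ‖ ≤ 4 * L ^ 2 * l1 (x - y) * g ∧ 4 * L ^ 2 * (l1 (x - y) : ℝ) * g ≤ 8 * L ^ 2 * S * g := by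
  have hLg : 0 ≤ L ^ 2 * g := mul_nonneg (sq_nonneg L) hg
  have hl : (2 : ℝ) * l1 (x - y) ≤ 3 * S := by exact_mod_cast two_mul_l1_le hx
  have hprod : 2 * (l1 (x - y) : ℝ) * (L ^ 2 * g) ≤ 3 * S * (L ^ 2 * g) := mul_le_mul_of_nonneg_right hl hLg
  have hS : 0 ≤ (S : ℝ) * (L ^ 2 * g) := mul_nonneg (Nat.cast_nonneg S) hLg
  exact ⟨eq28_first V hV y hLg h13 x μ (by linarith), by linarith⟩

/-- **(28) as printed** (`d = 3`): `□₁` the cube of side `3RM₁`, `R = R₁r(g₀)`, centred at `y` (`2|(c₋ − y)_κ| ≤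
3RM₁`), (13) with `2L²g₀p(g₀)`, and `8L²·3R₁M₁r(g₀)·g₀p(g₀) ≤ 1`: then `‖B(c)‖ ≤ 4L²|c₋ − y|₁g₀p(g₀) ≤
8L²3R₁M₁r(g₀)g₀p(g₀)` (`p` stands for the number `p(g₀)`, `r` for `r(g₀)`). [cite: Balaban1985UV3, (28) p.263] -/
theorem eq28_print (V : LSite 3 → Fin 3 → 𝔸ˣ) (hV : ∀ x κ, V x κ ∈ U1 𝔸) (y : LSite 3) {L g₀ p R₁ r M₁ : ℝ}
    (hgp : 0 ≤ g₀ * p)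
    (h13 : ∀ (x : LSite 3) (κ μ : Fin 3), κ ≠ μ →
      ‖((hol V x (plaqWord κ μ) : 𝔸ˣ) : 𝔸) - 1‖ ≤ 2 * L ^ 2 * (g₀ * p))
    {x : LSite 3} (hx : ∀ κ, 2 * (((x - y) κ).natAbs : ℝ) ≤ 3 * (R₁ * r) * M₁)
    (hsmall : 8 * L ^ 2 * (3 * R₁ * M₁ * r) * (g₀ * p) ≤ 1) (μ : Fin 3) :
    ‖B27 V y x μ‖ ≤ 4 * L ^ 2 * l1 (x - y) * (g₀ * p) ∧
      4 * L ^ 2 * (l1 (x - y) : ℝ) * (g₀ * p) ≤ 8 * L ^ 2 * (3 * R₁ * M₁ * r) * (g₀ * p) := by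
  have hLg : 0 ≤ L ^ 2 * (g₀ * p) := mul_nonneg (sq_nonneg L) hgp
  have hl : 2 * (l1 (x - y) : ℝ) ≤ 3 * (3 * (R₁ * r) * M₁) := by exact_mod_cast two_mul_l1_le_real hx
  have hR : (0 : ℝ) ≤ 3 * (R₁ * r) * M₁ := le_trans (by positivity) (hx 0)
  have hprod : 2 * (l1 (x - y) : ℝ) * (L ^ 2 * (g₀ * p)) ≤ 3 * (3 * (R₁ * r) * M₁) * (L ^ 2 * (g₀ * p)) :=
    mul_le_mul_of_nonneg_right hl hLg
  have hR' : 0 ≤ 3 * (R₁ * r) * M₁ * (L ^ 2 * (g₀ * p)) := mul_nonneg hR hLg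
  exact ⟨eq28_first V hV y hLg h13 x μ (by linarith), by linarith⟩

end Bound28

/-! ## §3′ (27)–(28) UNDER THE PRINTED LOCAL HYPOTHESIS: (13) for the plaquettes of a box containing `y` and the bond

Print defines `B` on `□₁` and has (13) on `Ω₁^{(1)}` (p. 259), not on all of `T^{(1)}`.  b07's clamping device
(`B7Prop1Local.clampCfg`: extend `V` from the box `[lo, hi]` to `ℤ^d` so that every plaquette variable of the
extension is `1` or a plaquette variable of `V` INSIDE the box) and the locality of tree transport
(`B8Ineq130.axialFn_congr`) localise §3: the holonomy (27) depends only on the bonds of any box containing `y`, `c₋`,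
`c₊`, and (28) holds assuming (13) only for the plaquettes of that box. -/

section Local

variable {d : ℕ}

section LocalGroup

variable {G : Type*} [Group G] {lo hi : LSite d}

/-- LOCALITY OF (27): the holonomy of `Γ_{y,c₋} ∪ c ∪ Γ_{c₊,y}` is determined by the bond variables of any box
containing `y`, `c₋ = x` and `c₊ = x + e_μ` (tree contours between points of a box stay in the box). [folklore] -/
theorem hol_contour27_congr {V V' : LSite d → Fin d → G} (h : AgreeOn lo hi V V') (y x : LSite d) (μ : Fin d)
    (hy : InBox lo hi y) (hx : InBox lo hi x) (hxe : InBox lo hi (x + e μ)) :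
    hol V y (contour27 y x μ) = hol V' y (contour27 y x μ) := by
  rw [hol_contour27, hol_contour27]
  show axialFn V y x * V x μ * (axialFn V y (x + e μ))⁻¹ = axialFn V' y x * V' x μ * (axialFn V' y (x + e μ))⁻¹
  rw [axialFn_congr h y x hy hx, axialFn_congr h y (x + e μ) hy hxe, h x μ hx hxe]

end LocalGroup

section LocalNormed

variable {𝔸 : Type*} [NormedRing 𝔸] [NormOneClass 𝔸] {lo hi : LSite d}

/-- `‖V(Γ_{y,c₋} ∪ c ∪ Γ_{c₊,y}) − 1‖ ≤ |c₋ − y|₁·α` assuming `|V(∂p) − 1| ≤ α` ONLY for the unit plaquettes of a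
box `[lo, hi]` containing `y`, `c₋`, `c₊` (§3 applied to b07's clamped extension `clampCfg lo hi V`).
[cite: Balaban1985Averaging, pp.24–25] -/
theorem norm_hol_contour27_sub_one_le_local (hlohi : ∀ i, lo i ≤ hi i) (V : LSite d → Fin d → 𝔸ˣ)
    (hV : ∀ x κ, V x κ ∈ U1 𝔸) (y : LSite d) {α : ℝ}
    (h44 : ∀ (x : LSite d) (κ μ : Fin d), κ ≠ μ → PlaqIn lo hi (x, κ, μ) →
      ‖((hol V x (plaqWord κ μ) : 𝔸ˣ) : 𝔸) - 1‖ ≤ α)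
    (hα : 0 ≤ α) (hy : InBox lo hi y) (x : LSite d) (μ : Fin d) (hx : InBox lo hi x)
    (hxe : InBox lo hi (x + e μ)) : ‖((hol V y (contour27 y x μ) : 𝔸ˣ) : 𝔸) - 1‖ ≤ l1 (x - y) * α := by
  rw [← hol_contour27_congr (clampCfg_agree V) y x μ hy hx hxe]
  exact norm_hol_contour27_sub_one_le (clampCfg lo hi V) (clampCfg_mem hV) y
    (fun z κ ν hne => norm_hol_plaqWord_clampCfg_le hlohi V hne hα (fun z' hp => h44 z' κ ν hne hp) z) hα x μ

variable [NormedAlgebra ℂ 𝔸]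

omit [NormOneClass 𝔸] in
/-- LOCALITY OF `B`: (27) is determined by the bond variables of any box containing `y`, `c₋`, `c₊`. [folklore] -/
theorem B27_congr {V V' : LSite d → Fin d → 𝔸ˣ} (h : AgreeOn lo hi V V') (y x : LSite d) (μ : Fin d)
    (hy : InBox lo hi y) (hx : InBox lo hi x) (hxe : InBox lo hi (x + e μ)) : B27 V y x μ = B27 V' y x μ := by
  rw [B27, B27, hol_contour27_congr h y x μ hy hx hxe]

variable [CompleteSpace 𝔸]

/-- **(28), generic form, LOCAL HYPOTHESIS**: `‖B(c)‖ ≤ 2|c₋ − y|₁·α` for `y`, `c₋`, `c₊` in a box on whose plaquettes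
`|V(∂p) − 1| ≤ α`, as long as `|c₋ − y|₁·α ≤ ½`. [cite: Balaban1985UV3, (28) p.263] -/
theorem norm_B27_le_local (hlohi : ∀ i, lo i ≤ hi i) (V : LSite d → Fin d → 𝔸ˣ) (hV : ∀ x κ, V x κ ∈ U1 𝔸)
    (y : LSite d) {α : ℝ}
    (h44 : ∀ (x : LSite d) (κ μ : Fin d), κ ≠ μ → PlaqIn lo hi (x, κ, μ) →
      ‖((hol V x (plaqWord κ μ) : 𝔸ˣ) : 𝔸) - 1‖ ≤ α)
    (hα : 0 ≤ α) (hy : InBox lo hi y) (x : LSite d) (μ : Fin d) (hx : InBox lo hi x)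
    (hxe : InBox lo hi (x + e μ)) (hsmall : (l1 (x - y) : ℝ) * α ≤ 1 / 2) :
    ‖B27 V y x μ‖ ≤ 2 * (l1 (x - y) * α) := by
  rw [norm_B27]
  have h := norm_hol_contour27_sub_one_le_local hlohi V hV y h44 hα hy x μ hx hxe
  exact (norm_mlog_le_two_mul (h.trans hsmall)).trans (by linarith)

/-- `exp(iB(c)) = V₀(c)` under the local hypothesis, on every bond of the box with `|c₋ − y|₁·α < 1`. [folklore] -/
theorem exp_I_smul_B27_local (hlohi : ∀ i, lo i ≤ hi i) (V : LSite d → Fin d → 𝔸ˣ) (hV : ∀ x κ, V x κ ∈ U1 𝔸)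
    (y : LSite d) {α : ℝ}
    (h44 : ∀ (x : LSite d) (κ μ : Fin d), κ ≠ μ → PlaqIn lo hi (x, κ, μ) →
      ‖((hol V x (plaqWord κ μ) : 𝔸ˣ) : 𝔸) - 1‖ ≤ α)
    (hα : 0 ≤ α) (hy : InBox lo hi y) (x : LSite d) (μ : Fin d) (hx : InBox lo hi x)
    (hxe : InBox lo hi (x + e μ)) (hlt : (l1 (x - y) : ℝ) * α < 1) :
    exp (Complex.I • B27 V y x μ) = ((hol V y (contour27 y x μ) : 𝔸ˣ) : 𝔸) :=
  exp_I_smul_B27 V y x μ ((norm_hol_contour27_sub_one_le_local hlohi V hV y h44 hα hy x μ hx hxe).trans_lt hlt)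

/-- **(28) as printed, LOCAL HYPOTHESIS** (`d = 3`): (13) assumed only for the plaquettes of a box containing `y` and
the bond, `c₋` in the cube of side `3RM₁` centred at `y`, `8L²·3R₁M₁r·g₀p ≤ 1` ⇒ both members of (28).
[cite: Balaban1985UV3, (28) p.263] -/
theorem eq28_print_local {lo hi : LSite 3} (hlohi : ∀ i, lo i ≤ hi i) (V : LSite 3 → Fin 3 → 𝔸ˣ)
    (hV : ∀ x κ, V x κ ∈ U1 𝔸) (y : LSite 3) (hy : InBox lo hi y) {L g₀ p R₁ r M₁ : ℝ} (hgp : 0 ≤ g₀ * p)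
    (h13 : ∀ (x : LSite 3) (κ μ : Fin 3), κ ≠ μ → PlaqIn lo hi (x, κ, μ) →
      ‖((hol V x (plaqWord κ μ) : 𝔸ˣ) : 𝔸) - 1‖ ≤ 2 * L ^ 2 * (g₀ * p))
    {x : LSite 3} (hx : InBox lo hi x) (hxy : ∀ κ, 2 * (((x - y) κ).natAbs : ℝ) ≤ 3 * (R₁ * r) * M₁)
    (hsmall : 8 * L ^ 2 * (3 * R₁ * M₁ * r) * (g₀ * p) ≤ 1) (μ : Fin 3) (hxe : InBox lo hi (x + e μ)) :
    ‖B27 V y x μ‖ ≤ 4 * L ^ 2 * l1 (x - y) * (g₀ * p) ∧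
      4 * L ^ 2 * (l1 (x - y) : ℝ) * (g₀ * p) ≤ 8 * L ^ 2 * (3 * R₁ * M₁ * r) * (g₀ * p) := by
  have hLg : 0 ≤ L ^ 2 * (g₀ * p) := mul_nonneg (sq_nonneg L) hgp
  have hl : 2 * (l1 (x - y) : ℝ) ≤ 3 * (3 * (R₁ * r) * M₁) := by exact_mod_cast two_mul_l1_le_real hxy
  have hR : (0 : ℝ) ≤ 3 * (R₁ * r) * M₁ := le_trans (by positivity) (hxy 0)
  have hprod : 2 * (l1 (x - y) : ℝ) * (L ^ 2 * (g₀ * p)) ≤ 3 * (3 * (R₁ * r) * M₁) * (L ^ 2 * (g₀ * p)) :=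
    mul_le_mul_of_nonneg_right hl hLg
  have hR' : 0 ≤ 3 * (R₁ * r) * M₁ * (L ^ 2 * (g₀ * p)) := mul_nonneg hR hLg
  have h := norm_B27_le_local hlohi V hV y h13 (by linarith) hy x μ hx hxe (by linarith)
  exact ⟨by linarith, by linarith⟩

end LocalNormed

end Local

/-! ## §4 Unitary-valued configurations: `B(c)` is self-adjoint -/

section Unitary

variable {d : ℕ} {𝔸 : Type*} [CStarAlgebra 𝔸]

/-- For a unit `u` with unitary value, `u⁻¹ = u⋆`. [folklore] -/
theorem val_inv_eq_star {u : 𝔸ˣ} (hu : (u : 𝔸) ∈ unitary 𝔸) : ((u⁻¹ : 𝔸ˣ) : 𝔸) = star (u : 𝔸) :=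
  Units.inv_eq_of_mul_eq_one_right (Unitary.mul_star_self_of_mem hu)

/-- The loop holonomy of (27) of a unitary-valued configuration is unitary (b07's `hol_mem_of`). [folklore] -/
theorem hol_contour27_mem_unitary {V : LSite d → Fin d → 𝔸ˣ} (hV : ∀ x κ, V x κ ∈ unitaryUnits 𝔸) (y x : LSite d)
    (μ : Fin d) : ((hol V y (contour27 y x μ) : 𝔸ˣ) : 𝔸) ∈ unitary 𝔸 :=
  mem_unitaryUnits.mp (hol_mem_of hV y _)

variable [Nontrivial 𝔸]

/-- Unitary-valued configurations are norm-bounded unit configurations (b07's `unitaryUnits_le_U1`). [folklore] -/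
theorem U1_of_unitaryUnits {V : LSite d → Fin d → 𝔸ˣ} (hV : ∀ x κ, V x κ ∈ unitaryUnits 𝔸) :
    ∀ x κ, V x κ ∈ U1 𝔸 := fun x κ => unitaryUnits_le_U1 (hV x κ)

/-- `iB(c) = log V₀(c)` is SKEW-ADJOINT for unitary-valued `V` on every bond with `|c₋ − y|₁·α ≤ ¼` (b07's
`star_mlog_eq_neg`). [folklore] -/
theorem I_smul_B27_mem_skewAdjoint {V : LSite d → Fin d → 𝔸ˣ} (hV : ∀ x κ, V x κ ∈ unitaryUnits 𝔸) (y : LSite d)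
    {α : ℝ} (h44 : ∀ (x : LSite d) (κ μ : Fin d), κ ≠ μ → ‖((hol V x (plaqWord κ μ) : 𝔸ˣ) : 𝔸) - 1‖ ≤ α)
    (hα : 0 ≤ α) (x : LSite d) (μ : Fin d) (hsmall : (l1 (x - y) : ℝ) * α ≤ 1 / 4) :
    Complex.I • B27 V y x μ ∈ skewAdjoint 𝔸 := by
  rw [skewAdjoint.mem_iff, I_smul_B27]
  exact star_mlog_eq_neg (hol_contour27_mem_unitary hV y x μ)
    ((norm_hol_contour27_sub_one_le V (U1_of_unitaryUnits hV) y h44 hα x μ).trans hsmall)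

/-- **`B(c)` is self-adjoint** (the `𝔤`-valuedness of (27) in the `U(𝔸)` model) on every bond with `|c₋ − y|₁·α ≤ ¼`.
[folklore] -/
theorem B27_mem_selfAdjoint {V : LSite d → Fin d → 𝔸ˣ} (hV : ∀ x κ, V x κ ∈ unitaryUnits 𝔸) (y : LSite d)
    {α : ℝ} (h44 : ∀ (x : LSite d) (κ μ : Fin d), κ ≠ μ → ‖((hol V x (plaqWord κ μ) : 𝔸ˣ) : 𝔸) - 1‖ ≤ α)
    (hα : 0 ≤ α) (x : LSite d) (μ : Fin d) (hsmall : (l1 (x - y) : ℝ) * α ≤ 1 / 4) :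
    B27 V y x μ ∈ selfAdjoint 𝔸 := by
  have h := I_smul_B27_mem_skewAdjoint hV y h44 hα x μ hsmall
  rw [skewAdjoint.mem_iff, star_smul, Complex.star_def, Complex.conj_I, ← neg_smul] at h
  exact (selfAdjoint.mem_iff).mpr (smul_right_injective 𝔸 (neg_ne_zero.mpr Complex.I_ne_zero) h)

/-- `exp(iB(c))` is unitary (it is `V₀(c)`) on every bond with `|c₋ − y|₁·α < 1`. [folklore] -/
theorem exp_I_smul_B27_mem_unitary {V : LSite d → Fin d → 𝔸ˣ} (hV : ∀ x κ, V x κ ∈ unitaryUnits 𝔸) (y : LSite d)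
    {α : ℝ} (h44 : ∀ (x : LSite d) (κ μ : Fin d), κ ≠ μ → ‖((hol V x (plaqWord κ μ) : 𝔸ˣ) : 𝔸) - 1‖ ≤ α)
    (hα : 0 ≤ α) (x : LSite d) (μ : Fin d) (hlt : (l1 (x - y) : ℝ) * α < 1) :
    exp (Complex.I • B27 V y x μ) ∈ unitary 𝔸 := by
  rw [exp_I_smul_B27_of_plaq V (U1_of_unitaryUnits hV) y h44 hα x μ hlt]
  exact hol_contour27_mem_unitary hV y x μ

end Unitary

/-! ## §5 The join with gen 25: the gauge-fixing datum of (29) DISCHARGED by the axial gauge on `ℤ^d` -/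

section Join

variable {d : ℕ} {𝔸 : Type*} [CStarAlgebra 𝔸]

/-- The bond `⟨x, x + e_μ⟩` of `ℤ^d` as an instance of b13's `Ends` (source `x`, target `x + e_μ`). [folklore] -/
def latEnds (d : ℕ) : Ends (LSite d × Fin d) (LSite d) where
  src b := b.1
  tgt b := b.1 + e b.2

/-- The value configuration of a unit configuration. [folklore] -/
def vals (V : LSite d → Fin d → 𝔸ˣ) : LSite d × Fin d → 𝔸 := fun b => ((V b.1 b.2 : 𝔸ˣ) : 𝔸)

/-- b13's value-level action `(Vᵘ)(x, x′) = u(x)V(x, x′)u(x′)⁻¹` ([13] (3.28), `Ring.inverse`) on the bonds of `ℤ^d` IS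
b07's `gaugeAct` on unit configurations. [folklore] -/
theorem gaugeAct_latEnds_vals (u : LSite d → 𝔸ˣ) (V : LSite d → Fin d → 𝔸ˣ) :
    B13Inv214Orbit.gaugeAct (latEnds d) (fun x => ((u x : 𝔸ˣ) : 𝔸)) (vals V) =
      vals (B7Prop1Explicit.gaugeAct u V) := by
  funext b
  simp only [B13Inv214Orbit.gaugeAct, latEnds, vals, B7Prop1Explicit.gaugeAct, Units.val_mul, Ring.inverse_unit]

open Classical in
/-- A value configuration with invertible values, lifted to a unit configuration (junk value `1` elsewhere). [folklore] -/
noncomputable def unitCfg (φ : LSite d × Fin d → 𝔸) : LSite d → Fin d → 𝔸ˣ :=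
  fun x μ => if h : IsUnit (φ (x, μ)) then h.unit else 1

/-- `unitCfg` has the prescribed values at invertible values. [folklore] -/
theorem val_unitCfg {φ : LSite d × Fin d → 𝔸} {x : LSite d} {μ : Fin d} (h : IsUnit (φ (x, μ))) :
    ((unitCfg φ x μ : 𝔸ˣ) : 𝔸) = φ (x, μ) := by
  simp [unitCfg, h]

/-- `vals ∘ unitCfg = id` on pointwise-invertible configurations. [folklore] -/
theorem vals_unitCfg {φ : LSite d × Fin d → 𝔸} (hφ : ∀ b, IsUnit (φ b)) : vals (unitCfg φ) = φ :=
  funext fun b => val_unitCfg (hφ b)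

/-- A unitary-valued value configuration lifts to a unitary-valued unit configuration. [folklore] -/
theorem unitCfg_mem_unitaryUnits {φ : LSite d × Fin d → 𝔸} (hφ : ∀ b, φ b ∈ unitary 𝔸) (x : LSite d) (κ : Fin d) :
    unitCfg φ x κ ∈ unitaryUnits 𝔸 := by
  rw [mem_unitaryUnits, val_unitCfg (isUnit_of_mem_unitary (hφ (x, κ)))]
  exact hφ (x, κ)

/-- The plaquette variable `V(∂p)` of the unit plaquette at `x` spanned by `e_κ, e_μ`, at value level for unitary-valued
configurations (`V_b⁻¹ = V_b⋆`): `V(x,κ) V(x + e_κ, μ) V(x + e_μ, κ)⋆ V(x, μ)⋆`. [cite: Balaban1985UV3, (13) p.259] -/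
def plaq (φ : LSite d × Fin d → 𝔸) (x : LSite d) (κ μ : Fin d) : 𝔸 :=
  φ (x, κ) * φ (x + e κ, μ) * star (φ (x + e μ, κ)) * star (φ (x, μ))

/-- For unitary-valued `φ`, b07's plaquette holonomy of the lift is the value-level plaquette variable. [folklore] -/
theorem val_hol_plaqWord {φ : LSite d × Fin d → 𝔸} (hφ : ∀ b, φ b ∈ unitary 𝔸) (x : LSite d) (κ μ : Fin d) :
    ((hol (unitCfg φ) x (plaqWord κ μ) : 𝔸ˣ) : 𝔸) = plaq φ x κ μ := by
  have hv : ∀ z ν, ((unitCfg φ z ν : 𝔸ˣ) : 𝔸) = φ (z, ν) := fun z ν => val_unitCfg (isUnit_of_mem_unitary (hφ (z, ν)))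
  have hi : ∀ z ν, (((unitCfg φ z ν)⁻¹ : 𝔸ˣ) : 𝔸) = star (φ (z, ν)) := fun z ν => by
    rw [val_inv_eq_star (by rw [hv]; exact hφ _), hv]
  simp only [plaqWord, hol_cons, hol_nil, mul_one, stepHol_true, stepHol_false, Units.val_mul, hv, hi, plaq,
    B7Prop1Explicit.Letter.vec_true, B7Prop1Explicit.Letter.vec_false, mul_assoc]
  abel_nf

/-- From the value-level (13)-type bounds to b07's plaquette hypothesis (44) for the lift. [folklore] -/
theorem h44_of_plaq {φ : LSite d × Fin d → 𝔸} (hφ : ∀ b, φ b ∈ unitary 𝔸) {α : ℝ}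
    (h13 : ∀ (x : LSite d) (κ μ : Fin d), κ ≠ μ → ‖plaq φ x κ μ - 1‖ ≤ α) :
    ∀ (x : LSite d) (κ μ : Fin d), κ ≠ μ → ‖((hol (unitCfg φ) x (plaqWord κ μ) : 𝔸ˣ) : 𝔸) - 1‖ ≤ α :=
  fun x κ μ hne => by rw [val_hol_plaqWord hφ]; exact h13 x κ μ hne

variable [Nontrivial 𝔸]

/-- **THE GAUGE-FIXING DATUM, DISCHARGED ON `ℤ^d`** (M3): for a unitary-valued configuration with `|V(∂p) − 1| ≤ α` on
the unit plaquettes, the axial gauge transformation `u = v₀ = axialFn V y` is unitary-valued and `(Vᵘ)(c) =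
exp(iB_V(c))` on every bond `c` with `|c₋ − y|₁·α < 1` — p. 263 *"there exists a gauge transformation in a
neighbourhood of □₁ … such that the gauge transformed U₁ is represented as exp i𝓗(B)"*, here with the axial
representative `B` of (27) itself (HONEST SCOPE (i)). [folklore] -/
theorem axial_gaugeFix {V : LSite d → Fin d → 𝔸ˣ} (hV : ∀ x κ, V x κ ∈ unitaryUnits 𝔸) (y : LSite d) {α : ℝ}
    (h44 : ∀ (x : LSite d) (κ μ : Fin d), κ ≠ μ → ‖((hol V x (plaqWord κ μ) : 𝔸ˣ) : 𝔸) - 1‖ ≤ α) (hα : 0 ≤ α) :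
    ∃ u : LSite d → 𝔸, (∀ x, u x ∈ unitary 𝔸) ∧ ∀ b : LSite d × Fin d, (l1 (b.1 - y) : ℝ) * α < 1 →
      B13Inv214Orbit.gaugeAct (latEnds d) u (vals V) b = exp (Complex.I • B27 V y b.1 b.2) := by
  refine ⟨fun x => ((axialFn V y x : 𝔸ˣ) : 𝔸), fun x => mem_unitaryUnits.mp (hol_mem_of hV y _), fun b hb => ?_⟩
  rw [gaugeAct_latEnds_vals, exp_I_smul_B27_of_plaq V (U1_of_unitaryUnits hV) y h44 hα b.1 b.2 hb, hol_contour27]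
  rfl

/-- The generator `gen X φ := iB_φ` of the axial representative, based at the centre `y X` of the cube `□ ∋ X`
(p. 263 *"Let y denote the center of □"*), on value configurations (via `unitCfg`). [cite: Balaban1985UV3, (27), (29) p.263] -/
noncomputable def axialGen {D : LocDomainSys} (y : D.Dom → LSite d) :
    D.Dom → (LSite d × Fin d → 𝔸) → LSite d × Fin d → 𝔸 :=
  fun X φ b => Complex.I • B27 (unitCfg φ) (y X) b.1 b.2

/-- **(29) ON `ℤ^d`, DATUM DISCHARGED**: (26) for site-dependent unitary-valued transformations (`SiteGaugeInv`, gen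
25), the localization of `E X` to the bonds `dep X` ("X̃⁵"), unitary values and the (13)-type plaquette bounds `≤ α`
on the space `sp' X`, and `dep X` within `ℓ¹`-radius `< 1/α` of `y X` ("X̃⁵ ⊂ □ ⊂ □₁") give `E X φ = E X (exp(iB_φ))`
— gen 25's `eq29_of_unitaryGaugeFix` with `hfix := axial_gaugeFix`. [cite: Balaban1985UV3, (29) p.263] -/
theorem eq29_axial {D : LocDomainSys} (y : D.Dom → LSite d) {α : ℝ} (hα : 0 ≤ α)
    {E : D.Dom → (LSite d × Fin d → 𝔸) → ℂ} {dep : D.Dom → Set (LSite d × Fin d)}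
    {sp' : D.Dom → Set (LSite d × Fin d → 𝔸)}
    (hloc : ∀ X (V V' : LSite d × Fin d → 𝔸), (∀ b ∈ dep X, V b = V' b) → E X V = E X V')
    (h26 : ∀ X, SiteGaugeInv (latEnds d) (E X))
    (hU : ∀ X φ, φ ∈ sp' X → ∀ b, φ b ∈ unitary 𝔸)
    (h13 : ∀ X φ, φ ∈ sp' X → ∀ (x : LSite d) (κ μ : Fin d), κ ≠ μ → ‖plaq φ x κ μ - 1‖ ≤ α)
    (hdep : ∀ X, ∀ b ∈ dep X, (l1 (b.1 - y X) : ℝ) * α < 1) :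
    ∀ X φ, φ ∈ sp' X → E X φ = E X (expLine (axialGen y) (fun _ _ _ => 1) X φ 1) := by
  refine eq29_of_unitaryGaugeFix (latEnds d) hloc h26 hU fun X φ hφ => ?_
  obtain ⟨u, hu1, hfix⟩ :=
    axial_gaugeFix (unitCfg_mem_unitaryUnits (hU X φ hφ)) (y X) (h44_of_plaq (hU X φ hφ) (h13 X φ hφ)) hα
  refine ⟨u, hu1, fun b hb => ?_⟩
  have hφ' : vals (unitCfg φ) = φ := vals_unitCfg fun b => isUnit_of_mem_unitary (hU X φ hφ b)
  calc B13Inv214Orbit.gaugeAct (latEnds d) u φ b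
        = B13Inv214Orbit.gaugeAct (latEnds d) u (vals (unitCfg φ)) b := by rw [hφ']
    _ = exp (Complex.I • B27 (unitCfg φ) (y X) b.1 b.2) := hfix b (hdep X b hb)
    _ = exp (axialGen y X φ b) := rfl

/-! ### The datum and (29) under the printed LOCAL hypothesis -/

omit [Nontrivial 𝔸] in
/-- From the value-level (13)-type bounds on the plaquettes of a box to b07's local hypothesis for the lift. [folklore] -/
theorem h44_of_plaq_local {lo hi : LSite d} {φ : LSite d × Fin d → 𝔸} (hφ : ∀ b, φ b ∈ unitary 𝔸) {α : ℝ}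
    (h13 : ∀ (x : LSite d) (κ μ : Fin d), κ ≠ μ → PlaqIn lo hi (x, κ, μ) → ‖plaq φ x κ μ - 1‖ ≤ α) :
    ∀ (x : LSite d) (κ μ : Fin d), κ ≠ μ → PlaqIn lo hi (x, κ, μ) →
      ‖((hol (unitCfg φ) x (plaqWord κ μ) : 𝔸ˣ) : 𝔸) - 1‖ ≤ α :=
  fun x κ μ hne hp => by rw [val_hol_plaqWord hφ]; exact h13 x κ μ hne hp

/-- **THE DATUM UNDER THE LOCAL HYPOTHESIS**: plaquette bounds only on a box `[lo, hi] ∋ y` ("a neighbourhood of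
□₁"); the axial transformation is unitary-valued and `(Vᵘ)(c) = exp(iB_V(c))` on every bond of the box with `|c₋ −
y|₁·α < 1`. [folklore] -/
theorem axial_gaugeFix_local {lo hi : LSite d} (hlohi : ∀ i, lo i ≤ hi i) {V : LSite d → Fin d → 𝔸ˣ}
    (hV : ∀ x κ, V x κ ∈ unitaryUnits 𝔸) (y : LSite d) (hy : InBox lo hi y) {α : ℝ}
    (h44 : ∀ (x : LSite d) (κ μ : Fin d), κ ≠ μ → PlaqIn lo hi (x, κ, μ) →
      ‖((hol V x (plaqWord κ μ) : 𝔸ˣ) : 𝔸) - 1‖ ≤ α) (hα : 0 ≤ α) :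
    ∃ u : LSite d → 𝔸, (∀ x, u x ∈ unitary 𝔸) ∧ ∀ b : LSite d × Fin d, InBox lo hi b.1 → InBox lo hi (b.1 + e b.2) →
      (l1 (b.1 - y) : ℝ) * α < 1 →
        B13Inv214Orbit.gaugeAct (latEnds d) u (vals V) b = exp (Complex.I • B27 V y b.1 b.2) := by
  refine ⟨fun x => ((axialFn V y x : 𝔸ˣ) : 𝔸), fun x => mem_unitaryUnits.mp (hol_mem_of hV y _),
    fun b hb1 hb2 hb => ?_⟩
  rw [gaugeAct_latEnds_vals,
    exp_I_smul_B27_local hlohi V (U1_of_unitaryUnits hV) y h44 hα hy b.1 b.2 hb1 hb2 hb, hol_contour27]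
  rfl

/-- **(29) ON `ℤ^d` UNDER THE PRINTED LOCAL HYPOTHESIS**: per domain `X` a box `[lo X, hi X]` ("a neighbourhood of
□₁") containing the base point `y X` and the bonds of `dep X` ("X̃⁵ ⊂ □"), (13)-type bounds `≤ α` for the plaquettes
of that box only, `dep X` within `ℓ¹`-radius `< 1/α` of `y X`; then `E X φ = E X (exp(iB_φ))` on `sp' X`.
[cite: Balaban1985UV3, (29) p.263] -/
theorem eq29_axial_local {D : LocDomainSys} (lo hi y : D.Dom → LSite d) (hlohi : ∀ X i, lo X i ≤ hi X i)
    (hy : ∀ X, InBox (lo X) (hi X) (y X)) {α : ℝ} (hα : 0 ≤ α)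
    {E : D.Dom → (LSite d × Fin d → 𝔸) → ℂ} {dep : D.Dom → Set (LSite d × Fin d)}
    {sp' : D.Dom → Set (LSite d × Fin d → 𝔸)}
    (hloc : ∀ X (V V' : LSite d × Fin d → 𝔸), (∀ b ∈ dep X, V b = V' b) → E X V = E X V')
    (h26 : ∀ X, SiteGaugeInv (latEnds d) (E X))
    (hU : ∀ X φ, φ ∈ sp' X → ∀ b, φ b ∈ unitary 𝔸)
    (h13 : ∀ X φ, φ ∈ sp' X → ∀ (x : LSite d) (κ μ : Fin d), κ ≠ μ → PlaqIn (lo X) (hi X) (x, κ, μ) →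
      ‖plaq φ x κ μ - 1‖ ≤ α)
    (hdep : ∀ X, ∀ b ∈ dep X, InBox (lo X) (hi X) b.1 ∧ InBox (lo X) (hi X) (b.1 + e b.2) ∧
      (l1 (b.1 - y X) : ℝ) * α < 1) :
    ∀ X φ, φ ∈ sp' X → E X φ = E X (expLine (axialGen y) (fun _ _ _ => 1) X φ 1) := by
  refine eq29_of_unitaryGaugeFix (latEnds d) hloc h26 hU fun X φ hφ => ?_
  obtain ⟨u, hu1, hfix⟩ := axial_gaugeFix_local (hlohi X) (unitCfg_mem_unitaryUnits (hU X φ hφ)) (y X) (hy X)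
    (h44_of_plaq_local (hU X φ hφ) (h13 X φ hφ)) hα
  refine ⟨u, hu1, fun b hb => ?_⟩
  have hφ' : vals (unitCfg φ) = φ := vals_unitCfg fun b => isUnit_of_mem_unitary (hU X φ hφ b)
  obtain ⟨hb1, hb2, hb3⟩ := hdep X b hb
  calc B13Inv214Orbit.gaugeAct (latEnds d) u φ b
        = B13Inv214Orbit.gaugeAct (latEnds d) u (vals (unitCfg φ)) b := by rw [hφ']
    _ = exp (Complex.I • B27 (unitCfg φ) (y X) b.1 b.2) := hfix b hb1 hb2 hb3
    _ = exp (axialGen y X φ b) := rfl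

/-! ### The truncated generator: the lineage's binder shapes `hgen`, `hbound` at every bond -/

/-- The axial generator truncated to the `ℓ¹`-ball of radius `N X` about `y X` ("restricted to □₁"): `iB_φ(c)` if
`|c₋ − y X|₁ ≤ N X`, else `0`. [cite: Balaban1985UV3, (27), (28) p.263] -/
noncomputable def axialGenLoc {D : LocDomainSys} (y : D.Dom → LSite d) (N : D.Dom → ℕ) :
    D.Dom → (LSite d × Fin d → 𝔸) → LSite d × Fin d → 𝔸 :=
  fun X φ b => if l1 (b.1 - y X) ≤ N X then Complex.I • B27 (unitCfg φ) (y X) b.1 b.2 else 0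

omit [Nontrivial 𝔸] in
/-- Inside the ball the truncated generator is the axial generator. [folklore] -/
theorem axialGenLoc_of_le {D : LocDomainSys} (y : D.Dom → LSite d) (N : D.Dom → ℕ) {X : D.Dom}
    (φ : LSite d × Fin d → 𝔸) {b : LSite d × Fin d} (h : l1 (b.1 - y X) ≤ N X) :
    axialGenLoc y N X φ b = Complex.I • B27 (unitCfg φ) (y X) b.1 b.2 := if_pos h

omit [Nontrivial 𝔸] in
/-- Outside the ball the truncated generator vanishes. [folklore] -/
theorem axialGenLoc_of_not_le {D : LocDomainSys} (y : D.Dom → LSite d) (N : D.Dom → ℕ) {X : D.Dom}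
    (φ : LSite d × Fin d → 𝔸) {b : LSite d × Fin d} (h : ¬ l1 (b.1 - y X) ≤ N X) :
    axialGenLoc y N X φ b = 0 := if_neg h

/-- The truncated generator is SKEW-ADJOINT AT EVERY BOND when `N X·α ≤ ¼` — the shape of the lineage's binder `hgen`
(`B10Eq29TubeLine.expLine_mem_tubeCfg`). [folklore] -/
theorem axialGenLoc_mem_skewAdjoint {D : LocDomainSys} (y : D.Dom → LSite d) (N : D.Dom → ℕ) {X : D.Dom}
    {φ : LSite d × Fin d → 𝔸} (hφ : ∀ b, φ b ∈ unitary 𝔸) {α : ℝ}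
    (h13 : ∀ (x : LSite d) (κ μ : Fin d), κ ≠ μ → ‖plaq φ x κ μ - 1‖ ≤ α) (hα : 0 ≤ α)
    (hN : (N X : ℝ) * α ≤ 1 / 4) (b : LSite d × Fin d) : axialGenLoc y N X φ b ∈ skewAdjoint 𝔸 := by
  unfold axialGenLoc
  split_ifs with h
  · exact I_smul_B27_mem_skewAdjoint (unitCfg_mem_unitaryUnits hφ) (y X) (h44_of_plaq hφ h13) hα b.1 b.2
      ((mul_le_mul_of_nonneg_right (by exact_mod_cast h) hα).trans hN)
  · exact zero_mem _

/-- The truncated generator is BOUNDED AT EVERY BOND, `‖gen X φ b‖ ≤ 2N X·α`, when `N X·α ≤ ½` — (28) on the ball, the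
shape of the lineage's binder `hbound` (with `q = 0`). [cite: Balaban1985UV3, (28) p.263] -/
theorem norm_axialGenLoc_le {D : LocDomainSys} (y : D.Dom → LSite d) (N : D.Dom → ℕ) {X : D.Dom}
    {φ : LSite d × Fin d → 𝔸} (hφ : ∀ b, φ b ∈ unitary 𝔸) {α : ℝ}
    (h13 : ∀ (x : LSite d) (κ μ : Fin d), κ ≠ μ → ‖plaq φ x κ μ - 1‖ ≤ α) (hα : 0 ≤ α)
    (hN : (N X : ℝ) * α ≤ 1 / 2) (b : LSite d × Fin d) : ‖axialGenLoc y N X φ b‖ ≤ 2 * (N X * α) := by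
  unfold axialGenLoc
  split_ifs with h
  · rw [norm_smul, Complex.norm_I, one_mul]
    have hl : (l1 (b.1 - y X) : ℝ) * α ≤ N X * α := mul_le_mul_of_nonneg_right (by exact_mod_cast h) hα
    exact (norm_B27_le (unitCfg φ) (U1_of_unitaryUnits (unitCfg_mem_unitaryUnits hφ)) (y X) (h44_of_plaq hφ h13) hα
      b.1 b.2 (hl.trans hN)).trans (by linarith)
  · rw [norm_zero]; exact mul_nonneg zero_le_two (mul_nonneg (Nat.cast_nonneg _) hα)

/-- **(29) with the truncated generator**: as `eq29_axial`, with `dep X` inside the `N X`-ball about `y X` and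
`N X·α < 1`. [cite: Balaban1985UV3, (29) p.263] -/
theorem eq29_axialLoc {D : LocDomainSys} (y : D.Dom → LSite d) (N : D.Dom → ℕ) {α : ℝ} (hα : 0 ≤ α)
    {E : D.Dom → (LSite d × Fin d → 𝔸) → ℂ} {dep : D.Dom → Set (LSite d × Fin d)}
    {sp' : D.Dom → Set (LSite d × Fin d → 𝔸)}
    (hloc : ∀ X (V V' : LSite d × Fin d → 𝔸), (∀ b ∈ dep X, V b = V' b) → E X V = E X V')
    (h26 : ∀ X, SiteGaugeInv (latEnds d) (E X))
    (hU : ∀ X φ, φ ∈ sp' X → ∀ b, φ b ∈ unitary 𝔸)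
    (h13 : ∀ X φ, φ ∈ sp' X → ∀ (x : LSite d) (κ μ : Fin d), κ ≠ μ → ‖plaq φ x κ μ - 1‖ ≤ α)
    (hdep : ∀ X, ∀ b ∈ dep X, l1 (b.1 - y X) ≤ N X) (hN : ∀ X, (N X : ℝ) * α < 1) :
    ∀ X φ, φ ∈ sp' X → E X φ = E X (expLine (axialGenLoc y N) (fun _ _ _ => 1) X φ 1) := by
  refine eq29_of_unitaryGaugeFix (latEnds d) hloc h26 hU fun X φ hφ => ?_
  obtain ⟨u, hu1, hfix⟩ :=
    axial_gaugeFix (unitCfg_mem_unitaryUnits (hU X φ hφ)) (y X) (h44_of_plaq (hU X φ hφ) (h13 X φ hφ)) hα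
  refine ⟨u, hu1, fun b hb => ?_⟩
  have hφ' : vals (unitCfg φ) = φ := vals_unitCfg fun b => isUnit_of_mem_unitary (hU X φ hφ b)
  have hb' : (l1 (b.1 - y X) : ℝ) * α < 1 :=
    (mul_le_mul_of_nonneg_right (by exact_mod_cast hdep X b hb) hα).trans_lt (hN X)
  calc B13Inv214Orbit.gaugeAct (latEnds d) u φ b
        = B13Inv214Orbit.gaugeAct (latEnds d) u (vals (unitCfg φ)) b := by rw [hφ']
    _ = exp (Complex.I • B27 (unitCfg φ) (y X) b.1 b.2) := hfix b hb'
    _ = exp (axialGenLoc y N X φ b) := by rw [axialGenLoc_of_le y N φ (hdep X b hb)]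

end Join

/-! ## §6 Non-vacuity -/

section Toys

variable {𝔸 : Type*} [CStarAlgebra 𝔸] [Nontrivial 𝔸]

/-- **(29) on `ℤ¹`, with content.**  In `d = 1` there are no plaquettes (`α = 0`, `B ≡ 0`), so `eq29_axial` applies
with `dep X`, `y X` ARBITRARY and yields: a (26)-invariant family `E X` (no localization needed: `dep X = univ`) is
CONSTANT on the unitary-valued configurations, `E X φ = E X 1` — every configuration on a tree is a pure gauge.  All
hypotheses of `eq29_axial` are thus jointly satisfiable with `D`, `E` free. [folklore] -/
theorem eq29_dim_one {D : LocDomainSys} (E : D.Dom → (LSite 1 × Fin 1 → 𝔸) → ℂ)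
    (h26 : ∀ X, SiteGaugeInv (latEnds 1) (E X)) :
    ∀ X φ, (∀ b, φ b ∈ unitary 𝔸) → E X φ = E X (fun _ => 1) := by
  intro X φ hφ
  have h := eq29_axial (𝔸 := 𝔸) (D := D) (fun _ => (0 : LSite 1)) (α := 0) le_rfl (E := E)
    (dep := fun _ => Set.univ) (sp' := fun _ => {ψ | ∀ b, ψ b ∈ unitary 𝔸})
    (fun X V V' hVV' => by rw [show V = V' from funext fun b => hVV' b (Set.mem_univ b)])
    h26 (fun _ _ hψ => hψ) (fun _ _ _ _ κ μ hne => absurd (Subsingleton.elim κ μ) hne)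
    (fun _ b _ => by rw [mul_zero]; exact one_pos) X φ hφ
  rw [h, expLine_one_one]
  congr 1
  funext b
  show exp (Complex.I • B27 (unitCfg φ) 0 b.1 b.2) = 1
  rw [B27_eq_zero_dim_one (unitCfg φ) (U1_of_unitaryUnits (unitCfg_mem_unitaryUnits hφ)), smul_zero, exp_zero]

/-- The datum in the smallest non-trivial geometry: on `ℤ¹` the axial transformation gauges EVERY unitary-valued
configuration to `1` at every bond (`exp(iB) = exp 0 = 1`). [folklore] -/
example {V : LSite 1 → Fin 1 → 𝔸ˣ} (hV : ∀ x κ, V x κ ∈ unitaryUnits 𝔸) (y : LSite 1) :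
    ∃ u : LSite 1 → 𝔸, (∀ x, u x ∈ unitary 𝔸) ∧ ∀ b, B13Inv214Orbit.gaugeAct (latEnds 1) u (vals V) b = 1 := by
  obtain ⟨u, hu, h⟩ := axial_gaugeFix hV y (α := 0) (fun _ κ μ hne => absurd (Subsingleton.elim κ μ) hne) le_rfl
  refine ⟨u, hu, fun b => ?_⟩
  rw [h b (by rw [mul_zero]; exact one_pos), B27_eq_zero_dim_one V (U1_of_unitaryUnits hV), smul_zero, exp_zero]

end Toys

end Literature.MathematicalPhysics.QuantumFieldTheory.Balaban1983to89.B10Eq27AxialLog
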